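import Literature.Analysis.SpecialFunctions.MatsubaraLorentzianSum
import HarnessLib

/-!
# Fermionic Matsubara sums over `ℤ`: bosonic SHIFTS re-index the fermionic lattice, and the two-sided Lorentzian-derivative sum
# `Σ_{n∈ℤ} (ωₙ² − e²)/(ωₙ² + e²)² = (β²/4)·sech²(βe/2)`

Topic `Literature/Analysis/SpecialFunctions` (companion of `MatsubaraSum.lean`, `MatsubaraLorentzianSum.lean`).  With `ωₙ = (2n+1)π/β`, `n ∈ ℤ`, and a bosonic
transfer frequency `Ω = 2mπ/β` (`m ∈ ℤ`): `Ω − ωₙ = ω_{m−1−n}`, so for EVERY (tsum-)function `f`, `Σ_{n∈ℤ} f(Ω − ωₙ) = Σ_{n∈ℤ} f(ωₙ)` (an `Equiv` of the index set —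
no convergence hypothesis, since `tsum` is invariant under equivalences); this is the re-indexing behind "the partner line of a pair bubble at transfer frequency `Ω`
runs over the same fermionic frequencies" (BGM 2006 §2.1 (2.3)).  And the two-sided versions of `MatsubaraLorentzianSum`: summability over `ℤ` and
`Σ_{n∈ℤ} (ωₙ² − e²)/(ωₙ² + e²)² = (β²/4)·sech²(βe/2)` (the negative frequencies `ω_{−n−1} = −ωₙ` contribute the same).
* `matsubara_bosonic_sub_fermionic`, **`tsum_int_matsubara_shift`**;
* `matsubara_neg_succ` (`ω_{−(n+1)} = −ωₙ`), `summable_int_one_div_matsubara_sq_add_sq`, `summable_int_matsubara_lorentzian_deriv`,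
  **`tsum_int_matsubara_lorentzian_deriv`**.
Everything is proved; no named fact.

## Sources
G. Benfatto, A. Giuliani, V. Mastropietro, Ann. Henri Poincaré 7 (2006), §2.1 (2.2)–(2.5) (`BenfattoGiulianiMastropietro2006`). [folklore]
-/

noncomputable section

open Real Filter
open scoped Topology

namespace Literature.Analysis.SpecialFunctions

/-! ### Bosonic shifts re-index the fermionic lattice -/

/-- `2mπ/β − (2n+1)π/β = (2(m−1−n)+1)π/β`. [cite: BenfattoGiulianiMastropietro2006, §2.1 (2.2)-(2.5)] -/
theorem matsubara_bosonic_sub_fermionic (β : ℝ) (m n : ℤ) :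
    2 * (m : ℝ) * π / β - (2 * (n : ℝ) + 1) * π / β = (2 * (((m - 1 - n : ℤ)) : ℝ) + 1) * π / β := by
  push_cast
  ring

/-- **Bosonic shift of a fermionic Matsubara sum**: `Σ_{n∈ℤ} f(2mπ/β − ωₙ) = Σ_{n∈ℤ} f(ωₙ)` for every `f` (re-indexing `n ↦ m − 1 − n`).
[cite: BenfattoGiulianiMastropietro2006, §2.1 (2.2)-(2.5)] -/
theorem tsum_int_matsubara_shift {E : Type*} [AddCommMonoid E] [TopologicalSpace E] (f : ℝ → E) (β : ℝ) (m : ℤ) :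
    ∑' n : ℤ, f (2 * (m : ℝ) * π / β - (2 * (n : ℝ) + 1) * π / β) = ∑' n : ℤ, f ((2 * (n : ℝ) + 1) * π / β) := by
  have h : ∀ n : ℤ, f (2 * (m : ℝ) * π / β - (2 * (n : ℝ) + 1) * π / β) = (fun k : ℤ => f ((2 * (k : ℝ) + 1) * π / β)) ((Equiv.subLeft (m - 1)) n) :=
    fun n => by rw [matsubara_bosonic_sub_fermionic, Equiv.subLeft_apply]
  simp_rw [h]
  exact Equiv.tsum_eq (Equiv.subLeft (m - 1)) (fun k : ℤ => f ((2 * (k : ℝ) + 1) * π / β))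

/-! ### Two-sided sums -/

/-- `ω_{−(n+1)} = −ωₙ`: `(2·(−(n+1)) + 1)π/β = −((2n+1)π/β)`. [cite: BenfattoGiulianiMastropietro2006, §2.1 (2.2)-(2.5)] -/
theorem matsubara_neg_succ (β : ℝ) (n : ℕ) : (2 * (((-(n + 1 : ℤ)) : ℤ) : ℝ) + 1) * π / β = -((2 * (n : ℝ) + 1) * π / β) := by
  push_cast
  ring

/-- `Σ_{n∈ℤ} 1/(ωₙ² + a²)` converges. [cite: BenfattoGiulianiMastropietro2006, §2.1 (2.2)-(2.5)] -/
theorem summable_int_one_div_matsubara_sq_add_sq {β : ℝ} (hβ : 0 < β) (a : ℝ) :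
    Summable fun n : ℤ => 1 / (((2 * (n : ℝ) + 1) * π / β) ^ 2 + a ^ 2) := by
  have hs := summable_one_div_matsubara_sq_add_sq hβ a
  refine Summable.of_nat_of_neg_add_one (f := fun n : ℤ => 1 / (((2 * (n : ℝ) + 1) * π / β) ^ 2 + a ^ 2)) ?_ ?_
  · exact hs.congr fun n => by push_cast; ring
  · exact hs.congr fun n => by push_cast; ring

/-- `Σ_{n∈ℤ} (ωₙ² − e²)/(ωₙ² + e²)²` converges. [cite: BenfattoGiulianiMastropietro2006, §2.1 (2.2)-(2.5)] -/
theorem summable_int_matsubara_lorentzian_deriv {β : ℝ} (hβ : 0 < β) (e : ℝ) :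
    Summable fun n : ℤ => (((2 * (n : ℝ) + 1) * π / β) ^ 2 - e ^ 2) / (((2 * (n : ℝ) + 1) * π / β) ^ 2 + e ^ 2) ^ 2 := by
  refine Summable.of_norm_bounded (summable_int_one_div_matsubara_sq_add_sq hβ 0) fun n => ?_
  rw [Real.norm_eq_abs, zero_pow two_ne_zero, add_zero]
  have hω : (2 * (n : ℝ) + 1) * π / β ≠ 0 := by
    have h1 : (2 * (n : ℝ) + 1) ≠ 0 := by
      intro h
      have : (2 * n + 1 : ℤ) = 0 := by exact_mod_cast h
      omega
    exact div_ne_zero (mul_ne_zero h1 Real.pi_ne_zero) hβ.ne'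
  exact abs_lorentzian_deriv_le hω e

/-- **`Σ_{n∈ℤ} (ωₙ² − e²)/(ωₙ² + e²)² = (β²/4)·sech(βe/2)²`** (twice the one-sided sum of `tsum_matsubara_lorentzian_deriv`).
[cite: BenfattoGiulianiMastropietro2006, §2.1 (2.2)-(2.5)] -/
theorem tsum_int_matsubara_lorentzian_deriv {β : ℝ} (hβ : 0 < β) (e : ℝ) :
    ∑' n : ℤ, (((2 * (n : ℝ) + 1) * π / β) ^ 2 - e ^ 2) / (((2 * (n : ℝ) + 1) * π / β) ^ 2 + e ^ 2) ^ 2 = β ^ 2 / 4 * sech (β * e / 2) ^ 2 := by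
  set g : ℕ → ℝ := fun n => (((2 * (n : ℝ) + 1) * π / β) ^ 2 - e ^ 2) / (((2 * (n : ℝ) + 1) * π / β) ^ 2 + e ^ 2) ^ 2 with hg
  have hgs : Summable g := by
    refine Summable.of_norm_bounded (summable_one_div_matsubara_sq (β := β) hβ) fun n => ?_
    rw [Real.norm_eq_abs]
    exact abs_lorentzian_deriv_le (matsubaraFreq_nat_ne_zero hβ n) e
  have hgv : ∑' n : ℕ, g n = β ^ 2 / 8 * sech (β * e / 2) ^ 2 := tsum_matsubara_lorentzian_deriv hβ e
  set f : ℤ → ℝ := fun n => (((2 * (n : ℝ) + 1) * π / β) ^ 2 - e ^ 2) / (((2 * (n : ℝ) + 1) * π / β) ^ 2 + e ^ 2) ^ 2 with hf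
  have hf1 : (fun n : ℕ => f n) = g := by funext n; simp [hf, hg]
  have hf2 : (fun n : ℕ => f (-(n + 1))) = g := by
    funext n
    simp only [hf, hg]
    have h := matsubara_neg_succ β n
    push_cast at h ⊢
    rw [show (2 * -((n : ℝ) + 1) + 1) * π / β = -((2 * (n : ℝ) + 1) * π / β) by ring, neg_sq]
  have h1 : Summable fun n : ℕ => f n := by rw [hf1]; exact hgs
  have h2 : Summable fun n : ℕ => f (-(n + 1)) := by rw [hf2]; exact hgs
  have h := tsum_of_nat_of_neg_add_one h1 h2
  rw [show (∑' n : ℤ, (((2 * (n : ℝ) + 1) * π / β) ^ 2 - e ^ 2) / (((2 * (n : ℝ) + 1) * π / β) ^ 2 + e ^ 2) ^ 2) = ∑' n : ℤ, f n from rfl, h, hf1, hf2, hgv]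
  ring

end Literature.Analysis.SpecialFunctions

end
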